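import Summits.CriticalPhenomena.Ising3D.TaylorTableOddCoeffTM2Rows
import Summits.CriticalPhenomena.Ising3D.TaylorTableHeadPartsL
import HarnessLib

/-!
# XXXIb: the merged-2 PART evaluator (Scal2, HeadPart2, famRem, term2, slice2, oddPartOK2, final Booleans) + absP/negI semantics
(cell `pub-ising3x`, seat boot-1 gen 15/16; the MERGED-2 (first-order) odd-head test chain, landed per LEAN-PLAN-MERGED2 in ten modules)

HONEST FRAMING: lottery ticket; floor = tightest certified 3D Ising CFT bounds; no exact-solution
claim without a proof. Island framing: certified exclusion region at stated derivative order and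
assumptions; not a determination of the 3D Ising critical exponents beyond that.

Drafted and kernel-checked as one combined file (oddtest2/lean-draft/Merged2CellCombined.lean, 83 theorems, standard axioms); landed in slices of ≤ 400 lines. [folklore]
-/

namespace Summit.CriticalPhenomena.Ising3D

open Finset Set
open Literature.Analysis.ValidatedNumerics Literature.Analysis.ValidatedNumerics.PolyMP
open Literature.Analysis.ValidatedNumerics.NumericsMP
open Literature.MathematicalPhysics.QuantumFieldTheory.ConformalBootstrap3D
open Literature.MathematicalPhysics.QuantumFieldTheory.ConformalBootstrap3D.HRTM
open Literature.MathematicalPhysics.QuantumFieldTheory.ConformalBootstrap3D.PointKernel (mulQ mem_mulQ legendreLamQ)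

namespace HeadParts2

open HRTMAB2 (T3 rowEntry2)




/-- The point scalars of the merged-2 test at the box centre and their first derivatives (all at scale `S`), and the second-order
scalar factor `4 (ln 2)² W² (1 + 10⁻⁶)`. `K`/`dK` are UNSIGNED (`(−1)^ℓ` is applied per cell). [folklore] -/
structure Scal2 where
  /-- `κ = 2^{−(ε0−σ0)}` -/
  K : MI
  /-- `ln2 · κ` -/
  dK : MI
  /-- `μσ/(2κ₀)` at the centre -/
  C0 : MI
  /-- `∂C0/∂x = 2 ln2 · C0` -/
  dC0x : MI
  /-- `−με/(2κ₀)` at the centre -/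
  Ct : MI
  /-- `∂Ct/∂y = 2 ln2 · Ct` -/
  dCty : MI
  /-- `U = 2·W·(ln 2)⁺`, `W = max(Wσ, Wε)`: every scalar is `c₀·e^u` with `|u| ≤ U` on the box -/
  U : ℚ
  deriving DecidableEq, Repr

/-- A merged-2 head part: the claimed four polynomials of the terms `t0 … t0+count−1`. [folklore] -/
structure HeadPart2 where
  /-- first term index -/
  t0 : ℕ
  /-- number of terms -/
  count : ℕ
  /-- claimed `B₀` part -/
  B0 : IPoly
  /-- claimed `B_x` part -/
  Bx : IPoly
  /-- claimed `B_y` part -/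
  By : IPoly
  /-- claimed absolute remainder part (nonnegative upper bounds) -/
  Rm : IPoly
  deriving DecidableEq, Repr

/-- Coefficientwise `[0, |I|·]` polynomial. [folklore] -/
def absP (P : IPoly) : IPoly := P.map fun I => ⟨0, I.absHi⟩

/-- Negation. [folklore] -/
def negI (P : IPoly) : IPoly := smulIntI (-1) P

/-- Split a triple Taylor model into the `τ⁰` and `τ¹` interval polynomials and the absolute bound polynomial of the `τ²` slot over
`|τ| ≤ W = Wn/Wd` (`[0, ⌈⌈|c₂| Wn / Wd⌉ Wn / Wd⌉]`). [folklore] -/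
def t3split (Wn : ℤ) (Wd : ℕ) (P : HRTMAB2.TPoly) : IPoly × IPoly × IPoly :=
  (P.map T3.c0, P.map T3.c1, P.map fun c => ⟨0, Numerics.cdiv (Numerics.cdiv (c.c2.absHi * Wn) Wd * Wn) Wd⟩)

/-- `|I|/S` as a rational (for the remainder's scalar factors). [folklore] -/
def aH (S : ℕ) (I : MI) : ℚ := (I.absHi : ℚ) / S

/-- The second-order remainder contribution of ONE family (RIGOROUS constants): literal orders `(L0, L1, L2)` weighted by the family's own
half-width `Wu`, table slots `(M0, M1, M2)` (`M1` weighted by `Wt`, `M2` already a bound), scalar `c = c₀ e^u`, `|u| ≤ U` (`varies`), or `c = 1`: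
with `Q` = the degree-≥ 2 part of `L·E`, `rem = |c₀|·Q + |c₀|U·(r₁m₀ + r₀m₁ + Q) + |c₀|U²·(r₀+r₁+r₂)(m₀+m₁+m₂)`. [folklore] -/
def famRem (S : ℕ) (U Wu Wt Cabs : ℚ) (varies : Bool) (L0 L1 L2 M0 M1 M2 : IPoly) : IPoly :=
  let r0 := absP L0
  let r1 := smulQI Wu (absP L1)
  let r2 := smulQI (Wu ^ 2) (absP L2)
  let m0 := absP M0
  let m1 := smulQI Wt (absP M1)
  let Q := addI (addI (mulI S r0 M2) (mulI S r1 m1)) (addI (mulI S r2 (addI m0 (addI m1 M2))) (mulI S r1 M2))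
  let base := smulQI Cabs Q
  if varies then
    addI (addI base (smulQI (Cabs * U) (addI (addI (mulI S r1 m0) (mulI S r0 m1)) Q)))
      (smulQI (Cabs * U * U) (mulI S (addI r0 (addI r1 r2)) (addI m0 (addI m1 M2))))
  else base

/-- **The merged-2 contribution of ONE head term** `(n, j)`: `(b₀, b_x, b_y, rem)`, weight `(λ_ℓ 2^n)⁻¹` included. Families:
`q̂₃` (variable `u_b`, `∂u_b/∂x = ∂u_b/∂y = ½`, table S, scalar `C3 = (−1)^ℓ κ`), `q̂₄ − q̂₅` (`u_σ = x`, table P, scalar 1), `ψ̂₀` (no δ,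
table M, scalar `C0`), `ψ̂_t` (`u_t = x − y`, table P, scalar `Ct`); `∂τ/∂x = 1`, `∂τ/∂y = −1`. [folklore] -/
def term2 (R : OddHeadRowsΔ) (C : EvenCellTM) (TS TP TM : List (List HRTMAB2.TPoly)) (sc : Scal2) (Wn : ℤ) (Wd : ℕ) (q : ℕ × ℕ) :
    IPoly × IPoly × IPoly × IPoly :=
  let S := R.S
  let n := q.1
  let j := q.2
  let sgn : ℤ := (-1) ^ C.ℓ
  let C3 := MI.mulInt sc.K sgn
  let dC3x := MI.mulInt sc.dK sgn
  let dC3y := MI.mulInt sc.dK (-sgn)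
  let w : ℚ := 1 / (legendreLamQ C.ℓ * 2 ^ n)
  let sh := PolyMP.ofRat S ((n : ℚ) + C.ctr)
  let L := R.lit j
  let f := fun (c m : ℕ) =>
    let t := proj5 L c
    shiftI S (match m with | 0 => t.1 | 1 => t.2.1 | _ => t.2.2) sh
  let MS := t3split Wn Wd (rowEntry2 TS C.nF n j)
  let MP := t3split Wn Wd (rowEntry2 TP C.nF n j)
  let MM := t3split Wn Wd (rowEntry2 TM C.nF n j)
  let q45 := fun (m : ℕ) => addI (f 1 m) (negI (f 2 m))
  let T3_00 := mulI S (f 0 0) MS.1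
  let T45_00 := mulI S (q45 0) MP.1
  let T0_00 := mulI S (f 3 0) MM.1
  let Tt_00 := mulI S (f 4 0) MP.1
  let b0 := addI (addI (smulI S C3 T3_00) T45_00) (addI (smulI S sc.C0 T0_00) (smulI S sc.Ct Tt_00))
  let T3_x := addI (smulQI (1 / 2) (mulI S (f 0 1) MS.1)) (mulI S (f 0 0) MS.2.1)
  let bx := addI (addI (addI (addI (smulI S C3 T3_x) (smulI S dC3x T3_00))
      (addI (mulI S (q45 1) MP.1) (mulI S (q45 0) MP.2.1)))
      (addI (smulI S sc.dC0x T0_00) (smulI S sc.C0 (mulI S (f 3 0) MM.2.1))))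
      (smulI S sc.Ct (addI (mulI S (f 4 1) MP.1) (mulI S (f 4 0) MP.2.1)))
  let T3_y := addI (smulQI (1 / 2) (mulI S (f 0 1) MS.1)) (negI (mulI S (f 0 0) MS.2.1))
  let by_ := addI (addI (addI (addI (smulI S C3 T3_y) (smulI S dC3y T3_00))
      (negI (mulI S (q45 0) MP.2.1)))
      (smulI S sc.C0 (negI (mulI S (f 3 0) MM.2.1))))
      (addI (smulI S sc.dCty Tt_00) (smulI S sc.Ct (addI (negI (mulI S (f 4 1) MP.1)) (negI (mulI S (f 4 0) MP.2.1)))))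
  let Ws := R.Wσ
  let We := R.Wε
  let Wt := R.Wt
  let rem := addI (addI (addI (addI
      (famRem S sc.U ((Ws + We) / 2) Wt (aH S C3) true (f 0 0) (f 0 1) (f 0 2) MS.1 MS.2.1 MS.2.2)
      (famRem S sc.U Ws Wt 1 false (f 1 0) (f 1 1) (f 1 2) MP.1 MP.2.1 MP.2.2))
      (famRem S sc.U Ws Wt 1 false (f 2 0) (f 2 1) (f 2 2) MP.1 MP.2.1 MP.2.2))
      (famRem S sc.U 0 Wt (aH S sc.C0) true (f 3 0) (f 3 1) (f 3 2) MM.1 MM.2.1 MM.2.2))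
      (famRem S sc.U Wt Wt (aH S sc.Ct) true (f 4 0) (f 4 1) (f 4 2) MP.1 MP.2.1 MP.2.2)
  (smulQI w b0, smulQI w bx, smulQI w by_, smulQI w rem)

/-- Sum of the four polynomials over a slice of head terms. [folklore] -/
def slice2 (R : OddHeadRowsΔ) (C : EvenCellTM) (TS TP TM : List (List HRTMAB2.TPoly)) (sc : Scal2) (Wn : ℤ) (Wd : ℕ) :
    List (ℕ × ℕ) → IPoly × IPoly × IPoly × IPoly
  | [] => ([], [], [], [])
  | q :: qs =>
      let t := term2 R C TS TP TM sc Wn Wd q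
      let r := slice2 R C TS TP TM sc Wn Wd qs
      (addI t.1 r.1, addI t.2.1 r.2.1, addI t.2.2.1 r.2.2.1, addI t.2.2.2 r.2.2.2)

/-- **Per-part check, merged-2**: the computed four polynomials of the part's slice are contained in the claims. [folklore] -/
def oddPartOK2 (R : OddHeadRowsΔ) (C : EvenCellTM) (TS TP TM : List (List HRTMAB2.TPoly)) (sc : Scal2) (Wn : ℤ) (Wd : ℕ)
    (p : HeadPart2) : Bool :=
  let v := slice2 R C TS TP TM sc Wn Wd ((C.F.drop p.t0).take p.count)
  subsetI v.1 p.B0 && subsetI v.2.1 p.Bx && subsetI v.2.2.1 p.By && subsetI v.2.2.2 p.Rm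

/-- Horner evaluation `Σ_k hi_k · m^k` of the UPPER endpoints at a nonnegative `m` (scaled by `S`): the bound of an absolute remainder
`|R(ρ)| ≤ Σ_k c_k |ρ|^k`, `0 ≤ c_k ≤ hi_k/S`, over `|ρ| ≤ m`. (NOT `hiB`: on `[lo, hi]` with `lo < 0` that bounds `Σ hi_k ρ^k`.) [folklore] -/
def remAbsB : IPoly → ℚ → ℚ
  | [], _ => 0
  | I :: Q, m => (I.hi : ℚ) + m * remAbsB Q m

/-- **Merged-2 core test** on `[lo, hi]`: `lowB(B₀) − Wσ·absB(B_x) − Wε·absB(B_y) − RemAbs(max(|lo|,|hi|)) > 0` (all `·/S`). [folklore] -/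
def oddCoreM2 (S : ℕ) (B0 Bx By Rm : IPoly) (Ws We : ℚ) (lo hi : ℚ) : Bool :=
  decide (Ws * (absB S Bx lo hi : ℚ) + We * (absB S By lo hi : ℚ) + remAbsB Rm (max |lo| |hi|) < (lowB S B0 lo hi : ℚ))

/-- Bisection of the merged-2 test to depth `d`. [folklore] -/
def posOnOddM2 (S : ℕ) (B0 Bx By Rm : IPoly) (Ws We : ℚ) : ℕ → ℚ → ℚ → Bool
  | 0, a, b => oddCoreM2 S B0 Bx By Rm Ws We a b
  | d + 1, a, b =>
      oddCoreM2 S B0 Bx By Rm Ws We a b ||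
        (posOnOddM2 S B0 Bx By Rm Ws We d a ((a + b) / 2) && posOnOddM2 S B0 Bx By Rm Ws We d ((a + b) / 2) b)

/-! ### Group parts and the final Boolean (as HeadPartsL / OddHeadDeltaMerged) -/

/-- Consecutive tiling of member parts from position `pos`. [folklore] -/
def chainFrom2 : ℕ → List HeadPart2 → Bool
  | _, [] => true
  | pos, p :: ps => decide (p.t0 = pos) && chainFrom2 (pos + p.count) ps

/-- Total term count of a part list. [folklore] -/
def countSum2 : List HeadPart2 → ℕ
  | [] => 0
  | p :: ps => p.count + countSum2 ps

/-- Coefficientwise sums of the four claims over a part list. [folklore] -/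
def sum4 : List HeadPart2 → IPoly × IPoly × IPoly × IPoly
  | [] => ([], [], [], [])
  | p :: ps =>
      let r := sum4 ps
      (addI p.B0 r.1, addI p.Bx r.2.1, addI p.By r.2.2.1, addI p.Rm r.2.2.2)

/-- The group part tiles its members. [folklore] -/
def groupTiles2 (g : HeadPart2) (ps : List HeadPart2) : Bool := chainFrom2 g.t0 ps && decide (countSum2 ps = g.count)

/-- The group's claims contain the summed member claims. [folklore] -/
def groupClaimsOK2 (g : HeadPart2) (ps : List HeadPart2) : Bool :=
  let v := sum4 ps
  subsetI v.1 g.B0 && subsetI v.2.1 g.Bx && subsetI v.2.2.1 g.By && subsetI v.2.2.2 g.Rm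

/-- Structural half of the final check: degree, pivots, head indices below `J`, tiling of the cell's head list by the parts. [folklore] -/
def oddHeadStructOK2 (R : OddHeadRowsΔ) (C : EvenCellTM) (ps : List HeadPart2) : Bool :=
  decide (2 ≤ C.D) && pivOK C.ctr C.ℓ C.e C.nF && (C.F.all fun q => decide (q.2 < R.J)) &&
    chainFrom2 0 ps && decide (countSum2 ps = C.F.length)

/-- **Final check, odd head, MERGED-2 form**: structure ∧ the bisected first-order merged sign test on the summed claims. [folklore] -/
def oddHeadFinalOK2 (R : OddHeadRowsΔ) (dP : ℕ) (C : EvenCellTM) (ps : List HeadPart2) : Bool :=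
  let v := sum4 ps
  oddHeadStructOK2 R C ps && posOnOddM2 R.S v.1 v.2.1 v.2.2.1 v.2.2.2 R.Wσ R.Wε dP (-C.hw) C.hw


/-! ### Semantics of `absP` / `negI` and absolute evaluation (bookkeeping lemmas for `term2_sound`, LEAN-PLAN item 2) -/

/-- `|a_k| ∈ absP P` coefficientwise. [folklore] -/
theorem pmem_absP {S : ℕ} : ∀ {as : List ℝ} {P : IPoly}, PMem S as P → PMem S (as.map fun a => |a|) (absP P)
  | _, _, List.Forall₂.nil => List.Forall₂.nil
  | _, _, List.Forall₂.cons (a := a) (b := I) h t => by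
      refine List.Forall₂.cons ?_ (pmem_absP t)
      have hb := MI.abs_le_absHi h
      have hS : (0 : ℝ) ≤ (S : ℝ) := by positivity
      refine ⟨?_, ?_⟩
      · simp only [Int.cast_zero]; positivity
      · simpa using hb

/-- The coefficients of `absP`-members built from absolute values are nonnegative. [folklore] -/
theorem nonneg_of_map_abs (as : List ℝ) : ∀ r ∈ as.map (fun a => |a|), 0 ≤ r := by
  intro r hr
  obtain ⟨a, _, rfl⟩ := List.mem_map.mp hr
  exact abs_nonneg a

/-- Real shadow of `remAbsB`: `Σ_k r_k m^k` by Horner. [folklore] -/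
noncomputable def remAbsR : List ℝ → ℝ → ℝ
  | [], _ => 0
  | r :: rs, m => r + m * remAbsR rs m

/-- `|Σ a_k ρ^k| ≤ Σ |a_k| |ρ|^k` in Horner form: `|evalR as ρ| ≤ remAbsR (as.map |·|) |ρ|`. [folklore] -/
theorem abs_evalR_le_remAbsR (ρ : ℝ) : ∀ as : List ℝ, |evalR as ρ| ≤ remAbsR (as.map fun a => |a|) |ρ|
  | [] => by simp [evalR, remAbsR]
  | a :: as => by
      simp only [evalR, List.map_cons, remAbsR]
      calc |a + ρ * evalR as ρ| ≤ |a| + |ρ * evalR as ρ| := abs_add_le _ _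
        _ = |a| + |ρ| * |evalR as ρ| := by rw [abs_mul]
        _ ≤ |a| + |ρ| * remAbsR (as.map fun a => |a|) |ρ| :=
            by gcongr; exact abs_evalR_le_remAbsR ρ as

/-- Negation of a member list lies in `negI`. [folklore] -/
theorem pmem_negI {S : ℕ} {as : List ℝ} {P : IPoly} (h : PMem S as P) : PMem S (smulR (((-1 : ℤ) : ℝ)) as) (negI P) :=
  pmem_smulIntI (-1) h

end HeadParts2

end Summit.CriticalPhenomena.Ising3D
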